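import Summits.CriticalPhenomena.PercolationContinuityZ3.Theorems.Transplant.SkelPhiNegReachRecs
import HarnessLib

/-!
# N1 (the `{±1}` node), (C) column under (ζ′) — file (C-S8-K): THE CORRIDOR BAND OF `800·kq` STRIDES AND ITS JOINS (the twin of the band part
# of `SkelPhiNegReachRecs` (C-S8, p300106) with the box multiplier `kq`): under (ζ′) (NEG-SCOPE §B.19: `A := 800·Kq`, stride := `s∥`, `K = 40·Kq`
# strides per `r`) the band from the last core of the u-rounds to the next cell's arrival box makes `20·r = 800·kq` strides (one cell), so the band
# record is `bandNw n ℓ h v T n N_C q_y N_C q_y Wmy Wpy du` with **`N_C := (800 * kq - 1) := 800·kq − 1`**; the closed forms `Qw, sA, WA, L0A, NA, L0B, NB,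
# qy, Wmy, Wpy` and the join `hjoinA` (A → B) are the record's (kq-free, reused from (C-S8)).
# * §1 `NCk_spec`, `NCk_cast`, `bandNw_NK`;
# * §2 the joins **`hjoinK`** (last core of B ⊆ first core of the band) and **`hregK`** (first core of the band ⊆ last region of B) — the record's
#   proofs verbatim (they never read `N_C`);
# * §3 **`hlenK`**: the corridor fits a step budget `nmax` once `N_A + N_B + 2 + 800·kq ≤ nmax + 1`.

builds on p205010 (kernel theorem, internal audit signed; external expert review pending) — nothing in this file uses p205010; nothing here is a
claim about the open node `SamePDropOfSkeletonNeg₁`.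
Lane `prim-bschramm`, seat `prim-bschramm-p5` (gen 11; (C) lineage); helper file (`--supports stmt-CriticalPhenomena-4575`).
[cite: KozmaNitzan2024, §4 Lemma 12 (pp. 23–25: the rounds into the target box, the corridor run), Lemma 11 (p. 22)] [cite: MartineauTassion2017, §4.3 Lemma 4.2]
-/

noncomputable section

namespace Summit.CriticalPhenomena.PercolationContinuityZ3.Theorems.Transplant

namespace Skelφ

namespace CorrRec

open Literature.Probability.Percolation Literature.Probability.LatticeModels
open Literature.Probability.Percolation.KozmaNitzan.Cells (oth sgOf sgOf_sign)
open ChainPlanar ChainPara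

/-- `oth 0 = 1` on `Fin 2`. [folklore] -/
private theorem oth_zero' : oth (0 : Fin 2) = 1 := by decide

/-- `oth 1 = 0` on `Fin 2`. [folklore] -/
private theorem oth_one' : oth (1 : Fin 2) = 0 := by decide

/-! ## §1 The band count under (ζ′): `N_C := 800·kq − 1` -/

/-- `N_C + 1 = 800·kq` (`1 ≤ kq`): under (ζ′) the band makes `800·kq = 20·K` strides (one cell of `20·r` fine units at `K = 40·kq` strides per `r`).
[folklore] -/
theorem NCk_spec {kq : ℕ} (hkq : 1 ≤ kq) : 800 * kq - 1 + 1 = 800 * kq := by omega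

/-- `N_C = 800·kq − 1` in `ℤ` (`1 ≤ kq`). [folklore] -/
theorem NCk_cast {kq : ℕ} (hkq : 1 ≤ kq) : ((800 * kq - 1 : ℕ) : ℤ) = 800 * (kq : ℤ) - 1 := by omega

/-- The band has `N_C + 1` strides either way: `(bandNw … N_C q_y N_C q_y …).N = N_C`. [folklore] -/
theorem bandNw_NK (N n ℓ : ℕ) (h v : ℤ) (T : ℕ) (aW bL : ℤ) (du : MDir) :
    (bandNw n ℓ h v T n N (qy n ℓ h v T aW bL) N (qy n ℓ h v T aW bL) (Wmy n v) (Wpy n v) du).N = N := by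
  unfold bandNw; split_ifs <;> rfl

/-! ## §2 The two joins with the band of `800·kq` strides -/

section Joins

variable {kq : ℕ} {n ℓ : ℕ} {h v : ℤ} {T : ℕ} {aW bL : ℤ} (hn : 1 ≤ n) (hvn : |v| ≤ n) (hlay : 2 * ((n + h.natAbs : ℕ) : ℤ) ≤ (n : ℤ) * ℓ + 1)
  (hWn : n ≤ WA n aW) (heA : ((T : ℤ) + 2) * ((n + h.natAbs : ℕ) : ℤ) ≤ (n : ℤ) * ℓ + 1) (heAn : T ≤ n)
  (hWB : n * ℓ / shearUnit n h + 1 ≤ Qw n ℓ h) (hWx : n * ℓ / shearUnit n h + 1 ≤ qy n ℓ h v T aW bL)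
  (hWmy : (n + v).toNat ≤ Wmy n v) (hWpy : (n - v).toNat ≤ Wpy n v)


/-- **Join B → band**: the last core of the u-rounds lies in the first core of the windowed band, either axis. [cite: KozmaNitzan2024, §4 Lemma 12] -/
theorem hjoinK (hT : T + 1 ≤ n) (du : MDir) :
    ((xLocPrm n ℓ h T (Qw n ℓ h) (L0B n ℓ h v T aW bL) (NB n ℓ h v T aW bL)).scheduleN 0 0 (xLocPrm_ok heAn hWB _ _)).core (NB n ℓ h v T aW bL + 1) ⊆
      ((bandNw n ℓ h v T n (800 * kq - 1) (qy n ℓ h v T aW bL) (800 * kq - 1) (qy n ℓ h v T aW bL) (Wmy n v) (Wpy n v) du).scheduleN du.1 (sgOf_sign du) 0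
        (bandNw_ok hn hvn hlay T n (800 * kq - 1) (qy n ℓ h v T aW bL) (800 * kq - 1) hWx hWmy hWpy du)
        (bandNw_eb n ℓ h v T n (800 * kq - 1) (qy n ℓ h v T aW bL) (800 * kq - 1) (qy n ℓ h v T aW bL) (Wmy n v) (Wpy n v) du)).core 0 := by
  intro y hy
  rw [LocPrm.mem_scheduleN_core_iff] at hy
  simp only [Pi.zero_apply, sub_zero, oth_zero'] at hy
  obtain ⟨h0, h1⟩ := hy
  have hL := LB_last_le (xLocPrm_ok heAn hWB (L0B n ℓ h v T aW bL) (NB n ℓ h v T aW bL)) hT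
  have hy0 : |y 0| ≤ n := h0.trans hL
  have hWk : (xLocPrm n ℓ h T (Qw n ℓ h) (L0B n ℓ h v T aW bL) (NB n ℓ h v T aW bL)).Wk (NB n ℓ h v T aW bL + 1) = (qy n ℓ h v T aW bL : ℕ) := by
    unfold LocPrm.Wk qy; push_cast; rfl
  rw [hWk] at h1
  rw [RunPrm.scheduleN_core, RunPrm.mem_pcore_iff (sgOf_sign du)]
  simp only [Pi.zero_apply, sub_zero, RunPrm.InCore, RunPrm.aLo, RunPrm.aHi, RunPrm.bLo, RunPrm.bHi]
  push_cast
  simp only [zero_mul, zero_sub, zero_add, sub_zero, add_zero]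
  have hσ1 : |sgOf du| = 1 := by rcases sgOf_sign du with hs | hs <;> simp [hs]
  by_cases hd : du.1 = 0
  · -- x-band: along `|y 0| ≤ n = q`, across `|y 1| ≤ q_y = window`
    simp only [bandNw, hd, if_true, oth_zero']
    have ha := abs_le.1 (show |sgOf du * y 0| ≤ n by rw [abs_mul, hσ1, one_mul]; exact hy0)
    have hb := abs_le.1 (show |sgOf du * y 1| ≤ (qy n ℓ h v T aW bL : ℕ) by rw [abs_mul, hσ1, one_mul]; exact h1)
    exact ⟨ha.1, ha.2, hb.1, hb.2⟩
  · -- y′-band: along `|y 1| ≤ q_y`, across `−Wmy ≤ σ·y 0 ≤ Wpy`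
    have hd1 : du.1 = 1 := by
      apply Fin.ext
      have h2 := du.1.isLt
      have h0 : du.1.val ≠ 0 := fun e => hd (Fin.ext e)
      rw [Fin.val_one]; omega
    have h10 : ¬ ((1 : Fin 2) = 0) := by decide
    simp only [bandNw, hd1, h10, if_false, oth_one', yPrmXw]
    have ha := abs_le.1 (show |sgOf du * y 1| ≤ (qy n ℓ h v T aW bL : ℕ) by rw [abs_mul, hσ1, one_mul]; exact h1)
    have hb := abs_le.1 (show |sgOf du * y 0| ≤ n by rw [abs_mul, hσ1, one_mul]; exact hy0)
    have hm : (n : ℤ) ≤ ((Wmy n v : ℕ) : ℤ) := by exact_mod_cast (n_le_Wy n v).1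
    have hp : (n : ℤ) ≤ ((Wpy n v : ℕ) : ℤ) := by exact_mod_cast (n_le_Wy n v).2
    exact ⟨ha.1, ha.2, by linarith [hb.1], by linarith [hb.2]⟩

/-- **The band's first core lies in the last region of the u-rounds** (`hreg`), either axis. [cite: KozmaNitzan2024, §4 Lemma 11 (p. 22)] -/
theorem hregK (du : MDir) :
    ((bandNw n ℓ h v T n (800 * kq - 1) (qy n ℓ h v T aW bL) (800 * kq - 1) (qy n ℓ h v T aW bL) (Wmy n v) (Wpy n v) du).scheduleN du.1 (sgOf_sign du) 0
        (bandNw_ok hn hvn hlay T n (800 * kq - 1) (qy n ℓ h v T aW bL) (800 * kq - 1) hWx hWmy hWpy du)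
        (bandNw_eb n ℓ h v T n (800 * kq - 1) (qy n ℓ h v T aW bL) (800 * kq - 1) (qy n ℓ h v T aW bL) (Wmy n v) (Wpy n v) du)).core 0 ⊆
      ((xLocPrm n ℓ h T (Qw n ℓ h) (L0B n ℓ h v T aW bL) (NB n ℓ h v T aW bL)).scheduleN 0 0 (xLocPrm_ok heAn hWB _ _)).region (NB n ℓ h v T aW bL) := by
  intro y hy
  have hσ1 : |sgOf du| = 1 := by rcases sgOf_sign du with hs | hs <;> simp [hs]
  rw [RunPrm.scheduleN_core, RunPrm.mem_pcore_iff (sgOf_sign du)] at hy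
  simp only [Pi.zero_apply, sub_zero, RunPrm.InCore, RunPrm.aLo, RunPrm.aHi, RunPrm.bLo, RunPrm.bHi] at hy
  push_cast at hy
  simp only [zero_mul, zero_sub, zero_add, sub_zero, add_zero] at hy
  rw [LocPrm.scheduleN_region, LocPrm.mem_pregion_iff]
  simp only [Pi.zero_apply, sub_zero, oth_zero', LocPrm.InRegion]
  have hLn : (n : ℤ) ≤ (xLocPrm n ℓ h T (Qw n ℓ h) (L0B n ℓ h v T aW bL) (NB n ℓ h v T aW bL)).L (NB n ℓ h v T aW bL) := n_le_LB _
  have hWk : (xLocPrm n ℓ h T (Qw n ℓ h) (L0B n ℓ h v T aW bL) (NB n ℓ h v T aW bL)).Wk (NB n ℓ h v T aW bL) + T = (qy n ℓ h v T aW bL : ℕ) := by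
    unfold LocPrm.Wk qy; push_cast; simp only [xLocPrm]; ring
  have he : ((xLocPrm n ℓ h T (Qw n ℓ h) (L0B n ℓ h v T aW bL) (NB n ℓ h v T aW bL)).e : ℤ) = T := rfl
  have hLa : ((xLocPrm n ℓ h T (Qw n ℓ h) (L0B n ℓ h v T aW bL) (NB n ℓ h v T aW bL)).La : ℤ) = n := rfl
  have hLb : (0 : ℤ) ≤ (xLocPrm n ℓ h T (Qw n ℓ h) (L0B n ℓ h v T aW bL) (NB n ℓ h v T aW bL)).Lb := by positivity
  rw [he, hLa]
  have hn0 : (0 : ℤ) ≤ n := by positivity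
  by_cases hd : du.1 = 0
  · simp only [bandNw, hd, if_true, oth_zero', xPrmWw] at hy
    obtain ⟨ha1, ha2, hb1, hb2⟩ := hy
    have ha : |y 0| ≤ n := by
      have := abs_le.2 ⟨ha1, ha2⟩; rwa [abs_mul, hσ1, one_mul] at this
    have hb : |y 1| ≤ (qy n ℓ h v T aW bL : ℕ) := by
      have := abs_le.2 ⟨hb1, hb2⟩; rwa [abs_mul, hσ1, one_mul] at this
    exact ⟨by linarith, by rw [← hWk] at hb; linarith⟩
  · have hd1 : du.1 = 1 := by
      apply Fin.ext
      have h2 := du.1.isLt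
      have h0 : du.1.val ≠ 0 := fun e => hd (Fin.ext e)
      rw [Fin.val_one]; omega
    have h10 : ¬ ((1 : Fin 2) = 0) := by decide
    simp only [bandNw, hd1, h10, if_false, oth_one', yPrmXw] at hy
    obtain ⟨ha1, ha2, hb1, hb2⟩ := hy
    have hm : ((Wmy n v : ℕ) : ℤ) ≤ n + |v| := by
      unfold Wmy; push_cast; rw [Int.toNat_eq_max]; linarith [max_le (le_abs_self v) (abs_nonneg v)]
    have hp : ((Wpy n v : ℕ) : ℤ) ≤ n + |v| := by
      unfold Wpy; push_cast; rw [Int.toNat_eq_max]; linarith [max_le (neg_le_abs v) (abs_nonneg v)]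
    have ha : |y 1| ≤ (qy n ℓ h v T aW bL : ℕ) := by
      have := abs_le.2 ⟨ha1, ha2⟩; rwa [abs_mul, hσ1, one_mul] at this
    have hb : |y 0| ≤ n + |v| := by
      have := abs_le.2 ⟨(neg_le_neg hm).trans hb1, hb2.trans hp⟩; rwa [abs_mul, hσ1, one_mul] at this
    exact ⟨by linarith [hvn], by rw [← hWk] at ha; linarith⟩


/-! ## §3 The step budget -/

/-- **The corridor fits the step budget `nmax`** once `N_A + N_B + 2 + 800·kq ≤ nmax + 1` (the band takes `800·kq`). [folklore] -/
theorem hlenK {nmax : ℕ} (hkq : 1 ≤ kq) (hAB : NA n ℓ h T bL + NB n ℓ h v T aW bL + 2 + 800 * kq ≤ nmax + 1) (du : MDir) :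
    (vLocPrmD n ℓ h v T (WA n aW) (L0A bL) (NA n ℓ h T bL)).N + 1 +
        ((xLocPrm n ℓ h T (Qw n ℓ h) (L0B n ℓ h v T aW bL) (NB n ℓ h v T aW bL)).N + 1 +
          (bandNw n ℓ h v T n (800 * kq - 1) (qy n ℓ h v T aW bL) (800 * kq - 1) (qy n ℓ h v T aW bL) (Wmy n v) (Wpy n v) du).N) ≤ nmax := by
  rw [bandNw_NK]
  show NA n ℓ h T bL + 1 + (NB n ℓ h v T aW bL + 1 + (800 * kq - 1)) ≤ nmax
  have := NCk_spec hkq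
  omega

end Joins

end CorrRec

end Skelφ

end Summit.CriticalPhenomena.PercolationContinuityZ3.Theorems.Transplant

end
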